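import Summits.CriticalPhenomena.Ising3DConformalLimit.Theorems.SubPtolemyInterlacingSubPtolemyFloorFloorOfDoubling
import Literature.Probability.LatticeModels.PointwiseScalingLimitEtaExists
import HarnessLib

/-!
# Doubling with `κ > 1/4` gives the `n^{-3/2}` floor (line `Sketch`, stub S5)

What: stub `stub_threeHalvesFloorOfDoubling` (S5, the DIVIDEND) of the line `Sketch` for the crux
`SubPtolemyFloor` (item stmt-CriticalPhenomena-15703, route `SubPtolemyInterlacing`). For the
critical nearest-neighbour Ising two-point function `G = criticalTwoPoint 3` on `ℤ³`, with
`g(n) := G(n e₁)`, `χ_N := Σ_{x ∈ box 3 N} G x` and `T_N := Σ_{k=1}^{N} k g(k)`: axial doubling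
`κ g(n) ≤ g(2n)` (`n ≥ 1`) with ANY `κ > 1/4` gives the floor `g(n) ≥ c n^{-3/2}` for all `n ≥ 1` —
the `η ≤ 1/2` bound of Duminil-Copin–Panis 2025, Theorem 1.5, WITHOUT assuming that `η` exists.

Proof sketch. The in-tree Theorem 1.3 of Duminil-Copin–Panis at `β_c`, `d = 3`
(`dcp_criticalTwoPoint_axis_lower_holds`; free state = plus state at `β_c` by
`twoPointPlus_criticalBeta_eq_twoPointFree_holds`) reads `g(n) ≥ c₁ / (χ_{4n} + n T_{2n})` for
`n ≥ N₁`. Under doubling both sums are carried by their top scale (scale-locality):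
* volume (threshold `1/8`): `χ_N ≤ D N³ g(N)` for `N ≥ 1` — this is the landed key lemma
  `floorOfDoubling_boxSum_le_of_doubling` of the sibling stub S2 (Messager–Miracle-Solé shells),
  imported and reused;
* area (threshold `1/4`, proved here along the DYADIC scales by a plain induction,
  `thf_dyadic_induction`, filled in by monotonicity, `thf_dyadic_fill`): the step
  `κ T_{2N} ≤ κ T_N + 4 N² g(2N)` (`thf_weighted_step`: for `N < k ≤ 2N`,
  `κ k g(k) ≤ 2N g(2k) ≤ 2N g(2N)` by doubling and axis antitonicity, at most `2N` terms) gives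
  `T_{2^j} ≤ D₀ 4^j g(2^j)` once `D₀ + 4 ≤ 4κD₀` (`D₀ = 1 + 4/(4κ-1)`), whence
  `T_N ≤ T_{2^{j+1}} ≤ 4 D₀ N² g(N)` for `2^j ≤ N < 2^{j+1}` (`thf_weighted_le`).
Assembly (`thf_sq_floor`, `stub_threeHalvesFloorOfDoubling`): for `n ≥ N₁` the denominator is
positive and `≤ D(4n)³ g(4n) + n D'(2n)² g(2n) ≤ (64D + 4D') n³ g(n)`, so
`c₁ ≤ (64D + 4D') n³ g(n)²`, i.e. `g(n) ≥ √(c₁/(64D + 4D')) n^{-3/2}`; for `1 ≤ n < N₁`,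
`g(n) ≥ g(N₁) ≥ g(N₁) n^{-3/2}`.

Sources: H. Duminil-Copin, R. Panis, *New lower bounds for the (near) critical Ising and φ⁴
models' two-point functions*, Comm. Math. Phys. 406 (2025) = arXiv:2404.05700, Theorem 1.3 (in
tree: `dcp_criticalTwoPoint_axis_lower_holds`) and Theorem 1.5 [DuminilCopinPanis2025LowerBounds];
tree facts `criticalTwoPoint_axis_antitone` / `_pos`, `criticalTwoPoint_zero'` / `_nonneg'`,
`dcp_denominator_pos`, and the landed S2 file (`floorOfDoubling_boxSum_le_of_doubling`,
`floorOfDoubling_natCast_zsmul_e1`).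
-/

noncomputable section

namespace Summit.CriticalPhenomena.Ising3DConformalLimit.SubPtolemyFloorSketch

open scoped BigOperators Classical
open Finset Literature.Probability.LatticeModels

/-- `(2^j)^p = (2^p)^j` in `ℝ`, with the base cast from `ℕ`. [folklore] -/
theorem thf_cast_two_pow_pow (j p : ℕ) : ((2 ^ j : ℕ) : ℝ) ^ p = ((2 : ℝ) ^ p) ^ j := by
  push_cast
  rw [← pow_mul, mul_comm, pow_mul]

/-! ## Dyadic scale-locality, abstractly -/

/-- Abstract dyadic induction: if `κ g(2^j) ≤ g(2^{j+1})`,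
`κ S(2^{j+1}) ≤ κ S(2^j) + A b^j g(2^{j+1})`, `S(1) ≤ D g(1)` and `D + A ≤ bκD` (`g, b, D ≥ 0`,
`κ > 0`), then `S(2^j) ≤ D b^j g(2^j)` for all `j`. [folklore] -/
theorem thf_dyadic_induction {κ b A D : ℝ} {S g : ℕ → ℝ} (hκ : 0 < κ) (hb : 0 ≤ b) (hD : 0 ≤ D)
    (hg : ∀ n, 0 ≤ g n) (hdouble : ∀ j : ℕ, κ * g (2 ^ j) ≤ g (2 ^ (j + 1)))
    (hstep : ∀ j : ℕ, κ * S (2 ^ (j + 1)) ≤ κ * S (2 ^ j) + A * b ^ j * g (2 ^ (j + 1)))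
    (hbase : S 1 ≤ D * g 1) (habs : D + A ≤ b * κ * D) (j : ℕ) :
    S (2 ^ j) ≤ D * b ^ j * g (2 ^ j) := by
  induction j with
  | zero => simpa only [pow_zero, mul_one] using hbase
  | succ j ih =>
    have hbj : 0 ≤ b ^ j := pow_nonneg hb j
    have h1 := mul_le_mul_of_nonneg_left ih hκ.le
    have h2 := mul_le_mul_of_nonneg_left (hdouble j) (mul_nonneg hD hbj)
    refine le_of_mul_le_mul_left ?_ hκ
    calc κ * S (2 ^ (j + 1)) ≤ κ * S (2 ^ j) + A * b ^ j * g (2 ^ (j + 1)) := hstep j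
      _ ≤ κ * (D * b ^ j * g (2 ^ j)) + A * b ^ j * g (2 ^ (j + 1)) := by linarith
      _ = D * b ^ j * (κ * g (2 ^ j)) + A * b ^ j * g (2 ^ (j + 1)) := by ring
      _ ≤ D * b ^ j * g (2 ^ (j + 1)) + A * b ^ j * g (2 ^ (j + 1)) := by linarith
      _ = (D + A) * (b ^ j * g (2 ^ (j + 1))) := by ring
      _ ≤ b * κ * D * (b ^ j * g (2 ^ (j + 1))) :=
          mul_le_mul_of_nonneg_right habs (mul_nonneg hbj (hg _))
      _ = κ * (D * b ^ (j + 1) * g (2 ^ (j + 1))) := by rw [pow_succ]; ring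

/-- Abstract dyadic fill-in: `S` monotone, `g ≥ 0` antitone, `S(2^j) ≤ D (2^p)^j g(2^j)` for all
`j` ⟹ `S(N) ≤ 2^p D N^p g(N)` for `N ≥ 1` (take `2^j ≤ N < 2^{j+1}`). [folklore] -/
theorem thf_dyadic_fill {D : ℝ} {p : ℕ} {S g : ℕ → ℝ} (hD : 0 ≤ D) (hg : ∀ n, 0 ≤ g n)
    (hganti : ∀ m n : ℕ, m ≤ n → g n ≤ g m) (hSmono : ∀ m n : ℕ, m ≤ n → S m ≤ S n)
    (h : ∀ j : ℕ, S (2 ^ j) ≤ D * ((2 : ℝ) ^ p) ^ j * g (2 ^ j)) {N : ℕ} (hN : 1 ≤ N) :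
    S N ≤ (2 : ℝ) ^ p * D * (N : ℝ) ^ p * g N := by
  obtain ⟨j, hj⟩ : ∃ j : ℕ, j = Nat.log 2 N := ⟨_, rfl⟩
  have hlow : 2 ^ j ≤ N := hj ▸ Nat.pow_log_le_self 2 (by omega)
  have hup : N < 2 ^ (j + 1) := hj ▸ Nat.lt_pow_succ_log_self one_lt_two N
  have hpow : ((2 : ℝ) ^ p) ^ (j + 1) ≤ (2 : ℝ) ^ p * (N : ℝ) ^ p := by
    have h1 : (2 : ℝ) ^ j ≤ N := by exact_mod_cast hlow
    have h2 : ((2 : ℝ) ^ j) ^ p ≤ (N : ℝ) ^ p := pow_le_pow_left₀ (by positivity) h1 p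
    rw [pow_succ, ← pow_mul, mul_comm p j, pow_mul, mul_comm]
    exact mul_le_mul_of_nonneg_left h2 (by positivity)
  calc S N ≤ S (2 ^ (j + 1)) := hSmono _ _ hup.le
    _ ≤ D * ((2 : ℝ) ^ p) ^ (j + 1) * g (2 ^ (j + 1)) := h (j + 1)
    _ ≤ D * ((2 : ℝ) ^ p * (N : ℝ) ^ p) * g N :=
        mul_le_mul (mul_le_mul_of_nonneg_left hpow hD) (hganti _ _ hup.le) (hg _) (by positivity)
    _ = (2 : ℝ) ^ p * D * (N : ℝ) ^ p * g N := by ring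

/-! ## Area: the weighted axis sum under doubling (threshold `1/4`) -/

/-- One doubling step for the weighted axis sum: `κ T_{2N} ≤ κ T_N + 4 N² g(2N)` (`N ≥ 1`): for
`N < k ≤ 2N`, `κ k g(k) ≤ 2N g(2k) ≤ 2N g(2N)`, and there are at most `2N` such `k`.
[folklore] -/
theorem thf_weighted_step {κ : ℝ} (hκ : 0 < κ)
    (hd : ∀ n : ℕ, 1 ≤ n → κ * criticalTwoPoint 3 (Pi.single 0 (n : ℤ)) ≤
      criticalTwoPoint 3 (Pi.single 0 ((2 * n : ℕ) : ℤ)))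
    (N : ℕ) (hN : 1 ≤ N) :
    κ * ∑ k ∈ Icc 1 (2 * N), (k : ℝ) * criticalTwoPoint 3 (Pi.single 0 (k : ℤ)) ≤
      κ * ∑ k ∈ Icc 1 N, (k : ℝ) * criticalTwoPoint 3 (Pi.single 0 (k : ℤ)) +
        4 * (N : ℝ) ^ 2 * criticalTwoPoint 3 (Pi.single 0 ((2 * N : ℕ) : ℤ)) := by
  have hsub : Icc 1 N ⊆ Icc 1 (2 * N) := Icc_subset_Icc_right (by omega)
  rw [← sum_sdiff hsub, mul_add]
  have hterm : ∀ k ∈ Icc 1 (2 * N) \ Icc 1 N,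
      κ * ((k : ℝ) * criticalTwoPoint 3 (Pi.single 0 (k : ℤ))) ≤
        2 * (N : ℝ) * criticalTwoPoint 3 (Pi.single 0 ((2 * N : ℕ) : ℤ)) := by
    intro k hk
    rw [mem_sdiff, mem_Icc, mem_Icc] at hk
    obtain ⟨⟨hk1, hk2⟩, hkN⟩ := hk
    have hle : 2 * N ≤ 2 * k := by omega
    have hk2' : (k : ℝ) ≤ 2 * N := by exact_mod_cast hk2
    have hgk : κ * criticalTwoPoint 3 (Pi.single 0 (k : ℤ)) ≤
        criticalTwoPoint 3 (Pi.single 0 ((2 * N : ℕ) : ℤ)) :=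
      (hd k hk1).trans (criticalTwoPoint_axis_antitone hle)
    calc κ * ((k : ℝ) * criticalTwoPoint 3 (Pi.single 0 (k : ℤ)))
        = (k : ℝ) * (κ * criticalTwoPoint 3 (Pi.single 0 (k : ℤ))) := by ring
      _ ≤ 2 * (N : ℝ) * criticalTwoPoint 3 (Pi.single 0 ((2 * N : ℕ) : ℤ)) :=
          mul_le_mul hk2' hgk (mul_nonneg hκ.le (criticalTwoPoint_nonneg' _)) (by positivity)
  have hcardN : #(Icc 1 (2 * N) \ Icc 1 N) ≤ 2 * N :=
    calc #(Icc 1 (2 * N) \ Icc 1 N) ≤ #(Icc 1 (2 * N)) := card_le_card sdiff_subset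
      _ = 2 * N + 1 - 1 := Nat.card_Icc 1 (2 * N)
      _ = 2 * N := by omega
  have hcard : (#(Icc 1 (2 * N) \ Icc 1 N) : ℝ) ≤ 2 * N := by exact_mod_cast hcardN
  have hg2N : 0 ≤ 2 * (N : ℝ) * criticalTwoPoint 3 (Pi.single 0 ((2 * N : ℕ) : ℤ)) :=
    mul_nonneg (by positivity) (criticalTwoPoint_nonneg' _)
  have hshell :
      κ * ∑ k ∈ Icc 1 (2 * N) \ Icc 1 N, (k : ℝ) * criticalTwoPoint 3 (Pi.single 0 (k : ℤ)) ≤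
        4 * (N : ℝ) ^ 2 * criticalTwoPoint 3 (Pi.single 0 ((2 * N : ℕ) : ℤ)) := by
    rw [mul_sum]
    calc ∑ k ∈ Icc 1 (2 * N) \ Icc 1 N, κ * ((k : ℝ) * criticalTwoPoint 3 (Pi.single 0 (k : ℤ)))
        ≤ #(Icc 1 (2 * N) \ Icc 1 N) •
            (2 * (N : ℝ) * criticalTwoPoint 3 (Pi.single 0 ((2 * N : ℕ) : ℤ))) :=
          sum_le_card_nsmul _ _ _ hterm
      _ = (#(Icc 1 (2 * N) \ Icc 1 N) : ℝ) *
            (2 * (N : ℝ) * criticalTwoPoint 3 (Pi.single 0 ((2 * N : ℕ) : ℤ))) := nsmul_eq_mul _ _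
      _ ≤ 2 * (N : ℝ) * (2 * (N : ℝ) * criticalTwoPoint 3 (Pi.single 0 ((2 * N : ℕ) : ℤ))) :=
          mul_le_mul_of_nonneg_right hcard hg2N
      _ = 4 * (N : ℝ) ^ 2 * criticalTwoPoint 3 (Pi.single 0 ((2 * N : ℕ) : ℤ)) := by ring
  linarith

/-- **Key lemma B (scale-locality of the area).** Under doubling with `κ > 1/4`,
`T_N = Σ_{k=1}^{N} k g(k) ≤ D' N² g(N)` for all `N ≥ 1`: dyadic induction through
`thf_weighted_step` with `D₀ = 1 + 4/(4κ-1)` (base `T_1 = g(1)`, absorption `D₀ + 4 ≤ 4κD₀`), then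
fill-in. [folklore] -/
theorem thf_weighted_le {κ : ℝ} (hκ : 1 / 4 < κ)
    (hd : ∀ n : ℕ, 1 ≤ n → κ * criticalTwoPoint 3 (Pi.single 0 (n : ℤ)) ≤
      criticalTwoPoint 3 (Pi.single 0 ((2 * n : ℕ) : ℤ))) :
    ∃ D : ℝ, 0 < D ∧ ∀ N : ℕ, 1 ≤ N →
      ∑ k ∈ Icc 1 N, (k : ℝ) * criticalTwoPoint 3 (Pi.single 0 (k : ℤ)) ≤
        D * (N : ℝ) ^ 2 * criticalTwoPoint 3 (Pi.single 0 (N : ℤ)) := by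
  have hκ0 : 0 < κ := by linarith
  have h4 : 0 < 4 * κ - 1 := by linarith
  obtain ⟨D, hD⟩ : ∃ D : ℝ, D = 1 + 4 / (4 * κ - 1) := ⟨_, rfl⟩
  have hB : 0 < 4 / (4 * κ - 1) := div_pos (by norm_num) h4
  have hD1 : 1 ≤ D := by rw [hD]; linarith
  have key : ∀ j : ℕ, ∑ k ∈ Icc (1 : ℕ) (2 ^ j), (k : ℝ) * criticalTwoPoint 3 (Pi.single 0 (k : ℤ)) ≤
      D * ((2 : ℝ) ^ 2) ^ j * criticalTwoPoint 3 (Pi.single 0 ((2 ^ j : ℕ) : ℤ)) := by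
    refine thf_dyadic_induction
      (S := fun N => ∑ k ∈ Icc 1 N, (k : ℝ) * criticalTwoPoint 3 (Pi.single 0 (k : ℤ)))
      (g := fun m : ℕ => criticalTwoPoint 3 (Pi.single 0 (m : ℤ))) (A := 4) hκ0 (by positivity)
      (by linarith) (fun m => criticalTwoPoint_nonneg' _) (fun j => ?_) (fun j => ?_) ?_ ?_
    · have h := hd (2 ^ j) Nat.one_le_two_pow
      rwa [← pow_succ'] at h
    · have h := thf_weighted_step hκ0 hd (2 ^ j) Nat.one_le_two_pow
      rwa [thf_cast_two_pow_pow, ← pow_succ'] at h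
    · rw [Icc_self, sum_singleton, Nat.cast_one, one_mul]
      exact le_mul_of_one_le_left (criticalTwoPoint_nonneg' _) hD1
    · have h1 : 4 ≤ D * (4 * κ - 1) := (div_le_iff₀ h4).1 (by rw [hD]; linarith)
      have h2 : (2 : ℝ) ^ 2 * κ * D = D * (4 * κ - 1) + D := by ring
      linarith
  refine ⟨(2 : ℝ) ^ 2 * D, by positivity, fun N hN => ?_⟩
  exact thf_dyadic_fill
    (S := fun N => ∑ k ∈ Icc 1 N, (k : ℝ) * criticalTwoPoint 3 (Pi.single 0 (k : ℤ)))
    (g := fun m : ℕ => criticalTwoPoint 3 (Pi.single 0 (m : ℤ))) (p := 2) (by linarith)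
    (fun m => criticalTwoPoint_nonneg' _) (fun m n h => criticalTwoPoint_axis_antitone h)
    (fun m n h => sum_le_sum_of_subset_of_nonneg (Icc_subset_Icc_right h) fun k _ _ =>
      mul_nonneg (Nat.cast_nonneg k) (criticalTwoPoint_nonneg' _)) key hN

/-! ## Assembly: Theorem 1.3 of Duminil-Copin–Panis under doubling -/

/-- **The denominator of DCP (1.9) under doubling, and the squared floor.** For `n ≥ N₁`,
`c₁ ≤ g(n) (χ_{4n} + n T_{2n}) ≤ (64 D + 4 D') n³ g(n)²`, i.e. `c₁/(64D + 4D') ≤ n³ g(n)²`, from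
the in-tree Theorem 1.3 at `β_c`, `d = 3` (`dcp_criticalTwoPoint_axis_lower_holds`; free state =
plus state by `twoPointPlus_criticalBeta_eq_twoPointFree_holds`) and the two key lemmas (volume:
the landed `floorOfDoubling_boxSum_le_of_doubling` of stub S2, threshold `1/8`; area:
`thf_weighted_le`, threshold `1/4`). [cite: DuminilCopinPanis2025LowerBounds, Theorem 1.3] -/
theorem thf_sq_floor {κ : ℝ} (hκ : 1 / 4 < κ)
    (hd : ∀ n : ℕ, 1 ≤ n →
      κ * criticalTwoPoint 3 ((n : ℤ) • (Pi.single 0 1 : Site 3)) ≤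
        criticalTwoPoint 3 (((2 * n : ℕ) : ℤ) • (Pi.single 0 1 : Site 3))) :
    ∃ c : ℝ, 0 < c ∧ ∃ N₁ : ℕ, 1 ≤ N₁ ∧ ∀ n : ℕ, N₁ ≤ n →
      c ≤ (n : ℝ) ^ 3 * criticalTwoPoint 3 (Pi.single 0 (n : ℤ)) ^ 2 := by
  have hd' : ∀ n : ℕ, 1 ≤ n → κ * criticalTwoPoint 3 (Pi.single 0 (n : ℤ)) ≤
      criticalTwoPoint 3 (Pi.single 0 ((2 * n : ℕ) : ℤ)) := fun n hn => by
    simpa only [floorOfDoubling_natCast_zsmul_e1] using hd n hn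
  obtain ⟨D, hD, hA⟩ := floorOfDoubling_boxSum_le_of_doubling (lt_trans (by norm_num) hκ) hd
  obtain ⟨D', hD', hB⟩ := thf_weighted_le hκ hd'
  have hGeq : ∀ x, criticalTwoPoint 3 x = twoPointFree 3 (criticalBeta 3) x :=
    twoPointPlus_criticalBeta_eq_twoPointFree_holds (d := 3) le_rfl
  obtain ⟨c₁, hc₁, N₁, hN₁, hdcp⟩ := dcp_criticalTwoPoint_axis_lower_holds (d := 3) le_rfl
  obtain ⟨E, hE⟩ : ∃ E : ℝ, E = 64 * D + 4 * D' := ⟨_, rfl⟩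
  have hEpos : 0 < E := by rw [hE]; positivity
  refine ⟨c₁ / E, div_pos hc₁ hEpos, N₁, hN₁, fun n hn => ?_⟩
  have h13 := hdcp n hn
  have e0 : (⟨0, by norm_num⟩ : Fin 3) = 0 := rfl
  rw [e0, show (3 - 2 : ℕ) = 1 from rfl, pow_one] at h13
  simp only [← hGeq] at h13
  have hpos := dcp_denominator_pos (F := criticalTwoPoint 3) criticalTwoPoint_zero'
    criticalTwoPoint_nonneg' 0 n
  have hc1le := (div_le_iff₀ hpos).1 h13
  have hgn : 0 ≤ criticalTwoPoint 3 (Pi.single 0 (n : ℤ)) := criticalTwoPoint_nonneg' _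
  have hden : (∑ x ∈ box 3 (4 * n), criticalTwoPoint 3 x) +
      (n : ℝ) * ∑ k ∈ Icc 1 (2 * n), (k : ℝ) * criticalTwoPoint 3 (Pi.single 0 (k : ℤ)) ≤
        E * (n : ℝ) ^ 3 * criticalTwoPoint 3 (Pi.single 0 (n : ℤ)) := by
    have hA' := hA (4 * n) (by omega)
    have hB' := hB (2 * n) (by omega)
    have hg4 : criticalTwoPoint 3 (Pi.single 0 ((4 * n : ℕ) : ℤ)) ≤
        criticalTwoPoint 3 (Pi.single 0 (n : ℤ)) := criticalTwoPoint_axis_antitone (by omega)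
    have hg2 : criticalTwoPoint 3 (Pi.single 0 ((2 * n : ℕ) : ℤ)) ≤
        criticalTwoPoint 3 (Pi.single 0 (n : ℤ)) := criticalTwoPoint_axis_antitone (by omega)
    have e4 : ((4 * n : ℕ) : ℝ) ^ 3 = 64 * (n : ℝ) ^ 3 := by push_cast; ring
    have e2 : ((2 * n : ℕ) : ℝ) ^ 2 = 4 * (n : ℝ) ^ 2 := by push_cast; ring
    rw [e4] at hA'
    rw [e2] at hB'
    have h1 : ∑ x ∈ box 3 (4 * n), criticalTwoPoint 3 x ≤
        D * (64 * (n : ℝ) ^ 3) * criticalTwoPoint 3 (Pi.single 0 (n : ℤ)) :=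
      hA'.trans (mul_le_mul_of_nonneg_left hg4 (by positivity))
    have h2 : (n : ℝ) * ∑ k ∈ Icc 1 (2 * n), (k : ℝ) * criticalTwoPoint 3 (Pi.single 0 (k : ℤ)) ≤
        (n : ℝ) * (D' * (4 * (n : ℝ) ^ 2) * criticalTwoPoint 3 (Pi.single 0 (n : ℤ))) :=
      mul_le_mul_of_nonneg_left (hB'.trans (mul_le_mul_of_nonneg_left hg2 (by positivity)))
        (Nat.cast_nonneg n)
    calc (∑ x ∈ box 3 (4 * n), criticalTwoPoint 3 x) +
          (n : ℝ) * ∑ k ∈ Icc 1 (2 * n), (k : ℝ) * criticalTwoPoint 3 (Pi.single 0 (k : ℤ))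
        ≤ D * (64 * (n : ℝ) ^ 3) * criticalTwoPoint 3 (Pi.single 0 (n : ℤ)) +
            (n : ℝ) * (D' * (4 * (n : ℝ) ^ 2) * criticalTwoPoint 3 (Pi.single 0 (n : ℤ))) :=
          add_le_add h1 h2
      _ = E * (n : ℝ) ^ 3 * criticalTwoPoint 3 (Pi.single 0 (n : ℤ)) := by rw [hE]; ring
  rw [div_le_iff₀' hEpos]
  calc c₁ ≤ criticalTwoPoint 3 (Pi.single 0 (n : ℤ)) * _ := hc1le
    _ ≤ criticalTwoPoint 3 (Pi.single 0 (n : ℤ)) *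
          (E * (n : ℝ) ^ 3 * criticalTwoPoint 3 (Pi.single 0 (n : ℤ))) :=
        mul_le_mul_of_nonneg_left hden hgn
    _ = E * ((n : ℝ) ^ 3 * criticalTwoPoint 3 (Pi.single 0 (n : ℤ)) ^ 2) := by ring

/-! ## The stub -/

/-- **S5 — dividend: doubling with `κ > 1/4` gives the `n^{-3/2}` floor unconditionally** (the
η ≤ 1/2 bound of Duminil-Copin–Panis WITHOUT assuming that η exists). From the in-tree DCP
Theorem 1.3 `dcp_criticalTwoPoint_axis_lower_holds` (`d = 3`, free = plus at `β_c` by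
`twoPointPlus_criticalBeta_eq_twoPointFree_holds`): `g(n) ≥ c₁/(χ_{4n} + n Σ_{k≤2n} k g(k))`, and
under doubling `χ_{4n} ≤ C_κ n³ g(n)` (threshold 1/8), `n Σ_{k≤2n} k g(k) ≤ C_κ n³ g(n)`
(threshold 1/4), so `g(n)² ≥ c n^{-3}` (`thf_sq_floor`); small `n` by axis antitonicity.
[cite: DuminilCopinPanis2025LowerBounds, Theorem 1.3 and Theorem 1.5] -/
theorem stub_threeHalvesFloorOfDoubling :
    ∀ κ : ℝ, 1 / 4 < κ →
      (∀ n : ℕ, 1 ≤ n →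
        κ * criticalTwoPoint 3 ((n : ℤ) • (Pi.single 0 1 : Site 3)) ≤
          criticalTwoPoint 3 (((2 * n : ℕ) : ℤ) • (Pi.single 0 1 : Site 3))) →
      ∃ c : ℝ, 0 < c ∧ ∀ n : ℕ, 1 ≤ n →
        c * (n : ℝ) ^ (-(3 / 2 : ℝ)) ≤ criticalTwoPoint 3 ((n : ℤ) • (Pi.single 0 1 : Site 3)) := by
  intro κ hκ hd
  obtain ⟨c₂, hc₂, N₁, -, hsq⟩ := thf_sq_floor hκ hd
  simp only [floorOfDoubling_natCast_zsmul_e1]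
  have hgN : 0 < criticalTwoPoint 3 (Pi.single 0 (N₁ : ℤ)) := criticalTwoPoint_axis_pos N₁
  refine ⟨min (Real.sqrt c₂) (criticalTwoPoint 3 (Pi.single 0 (N₁ : ℤ))),
    lt_min (Real.sqrt_pos.2 hc₂) hgN, fun n hn => ?_⟩
  have hn0 : (0 : ℝ) < n := by exact_mod_cast hn
  have hrpos : 0 < (n : ℝ) ^ (-(3 / 2 : ℝ)) := Real.rpow_pos_of_pos hn0 _
  rcases le_or_gt N₁ n with h | h
  · -- large `n`: the squared floor `c₂ ≤ n³ g(n)² = (g(n) n^{3/2})²`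
    have hgn : 0 ≤ criticalTwoPoint 3 (Pi.single 0 (n : ℤ)) := criticalTwoPoint_nonneg' _
    have h32 : 0 < (n : ℝ) ^ (3 / 2 : ℝ) := Real.rpow_pos_of_pos hn0 _
    have hsq' : (criticalTwoPoint 3 (Pi.single 0 (n : ℤ)) * (n : ℝ) ^ (3 / 2 : ℝ)) ^ 2 =
        (n : ℝ) ^ 3 * criticalTwoPoint 3 (Pi.single 0 (n : ℤ)) ^ 2 := by
      have h3 : ((n : ℝ) ^ (3 / 2 : ℝ)) ^ 2 = (n : ℝ) ^ 3 := by
        rw [← Real.rpow_natCast ((n : ℝ) ^ (3 / 2 : ℝ)) 2, ← Real.rpow_mul hn0.le]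
        norm_num
      rw [mul_pow, h3, mul_comm]
    calc min (Real.sqrt c₂) (criticalTwoPoint 3 (Pi.single 0 (N₁ : ℤ))) * (n : ℝ) ^ (-(3 / 2 : ℝ))
        ≤ Real.sqrt c₂ * (n : ℝ) ^ (-(3 / 2 : ℝ)) :=
          mul_le_mul_of_nonneg_right (min_le_left _ _) hrpos.le
      _ ≤ criticalTwoPoint 3 (Pi.single 0 (n : ℤ)) := by
          rw [Real.rpow_neg hn0.le, ← div_eq_mul_inv, div_le_iff₀ h32]
          calc Real.sqrt c₂
              ≤ Real.sqrt ((criticalTwoPoint 3 (Pi.single 0 (n : ℤ)) * (n : ℝ) ^ (3 / 2 : ℝ)) ^ 2) :=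
                Real.sqrt_le_sqrt (by rw [hsq']; exact hsq n h)
            _ = criticalTwoPoint 3 (Pi.single 0 (n : ℤ)) * (n : ℝ) ^ (3 / 2 : ℝ) :=
                Real.sqrt_sq (mul_nonneg hgn h32.le)
  · -- small `n`: `g(n) ≥ g(N₁) ≥ g(N₁) n^{-3/2}`
    calc min (Real.sqrt c₂) (criticalTwoPoint 3 (Pi.single 0 (N₁ : ℤ))) * (n : ℝ) ^ (-(3 / 2 : ℝ))
        ≤ criticalTwoPoint 3 (Pi.single 0 (N₁ : ℤ)) * (n : ℝ) ^ (-(3 / 2 : ℝ)) :=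
          mul_le_mul_of_nonneg_right (min_le_right _ _) hrpos.le
      _ ≤ criticalTwoPoint 3 (Pi.single 0 (N₁ : ℤ)) :=
          mul_le_of_le_one_right hgN.le
            (Real.rpow_le_one_of_one_le_of_nonpos (by exact_mod_cast hn) (by norm_num))
      _ ≤ criticalTwoPoint 3 (Pi.single 0 (n : ℤ)) := criticalTwoPoint_axis_antitone h.le

end Summit.CriticalPhenomena.Ising3DConformalLimit.SubPtolemyFloorSketch

end
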